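import Mathlib

/-!
# Tier7/Line3/KernelUniqueness — two continuous kernels of one integral operator agree (seat t7-x1)

LINE 3 (t7-plan-3), version-(ii): the relative trace identity for the `L¹` test function `f` (STATUS l. 14985
(2)): the Poincaré series `K_f(x, y) = Σ_γ f(x⁻¹ γ y)` is a continuous integral kernel of `R(f)` on `L²([G])`
(unfolding), and the finite spectral sum `Σ_{π ∈ Π(f)} Σ_φ (R(f)φ)(x) conj φ(y)` is another continuous kernel of
the same finite-rank operator. THIS FILE is step (c): on a compact space with a finite measure of full support,
two continuous kernels whose integral operators agree on every continuous test function are EQUAL everywhere —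
take `ψ := conj (K₁(x,·) − K₂(x,·))`, so `∫ |K₁ − K₂|²(x, ·) = 0`, hence a.e. zero, hence zero by continuity
(`Continuous.ae_eq_iff_eq`). Integrating the equal kernels over `[T_A] × [T_B]` against the characters is then
the identity `Σ_γ O_γ(f) = Σ_{π ∈ Π(f)} ⟨π(f) v_{B,π}, v_{A,π}⟩` with a FINITE spectral side.

Mathlib only; nothing here is about a group, a kernel of a specific operator, or a period. Blind lane; no sorry;
axioms ⊆ {propext, Classical.choice, Quot.sound}.
-/

namespace Summit.Ventures.HodgeRepro2.Tier7.Line3.KernelUniqueness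

open MeasureTheory

variable {X : Type*} [TopologicalSpace X] [CompactSpace X] [MeasurableSpace X]
  [OpensMeasurableSpace X] (μ : Measure X) [IsFiniteMeasureOnCompacts μ] [μ.IsOpenPosMeasure]

omit [μ.IsOpenPosMeasure] in
/-- a continuous function on a compact space is integrable. -/
theorem integrable_of_continuous {g : X → ℂ} (hg : Continuous g) : Integrable g μ :=
  hg.integrable_of_hasCompactSupport (HasCompactSupport.of_compactSpace g)

/-- **a continuous function whose integral against its own conjugate vanishes is zero**
(`∫ |g|² = 0`, full support). -/
theorem eq_zero_of_integral_mul_conj_eq_zero {g : X → ℂ} (hg : Continuous g)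
    (h : ∫ y, g y * (starRingEnd ℂ) (g y) ∂μ = 0) : g = 0 := by
  have hsq : ∀ y, g y * (starRingEnd ℂ) (g y) = ((Complex.normSq (g y) : ℝ) : ℂ) := fun y =>
    Complex.mul_conj (g y)
  have hint : ∫ y, (Complex.normSq (g y) : ℝ) ∂μ = 0 := by
    have h' : ∫ y, ((Complex.normSq (g y) : ℝ) : ℂ) ∂μ = 0 := by
      rw [← h]; exact integral_congr_ae (Filter.Eventually.of_forall fun y => (hsq y).symm)
    rw [integral_complex_ofReal] at h'
    exact_mod_cast h'
  have hcont : Continuous fun y => Complex.normSq (g y) := Complex.continuous_normSq.comp hg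
  have hintg : Integrable (fun y => Complex.normSq (g y)) μ :=
    hcont.integrable_of_hasCompactSupport (HasCompactSupport.of_compactSpace _)
  have hae : (fun y => Complex.normSq (g y)) =ᵐ[μ] 0 :=
    (integral_eq_zero_iff_of_nonneg (fun y => Complex.normSq_nonneg _) hintg).1 hint
  have heq : (fun y => Complex.normSq (g y)) = 0 := (Continuous.ae_eq_iff_eq μ hcont continuous_const).1 hae
  funext y
  have := congrFun heq y
  simp only [Pi.zero_apply] at this
  exact Complex.normSq_eq_zero.1 this

/-- **two continuous kernels with the same integral operator on continuous test functions are equal.** -/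
theorem eq_of_forall_integral_eq (K₁ K₂ : X → X → ℂ) (h₁ : Continuous (Function.uncurry K₁))
    (h₂ : Continuous (Function.uncurry K₂))
    (h : ∀ x, ∀ ψ : X → ℂ, Continuous ψ → ∫ y, K₁ x y * ψ y ∂μ = ∫ y, K₂ x y * ψ y ∂μ) :
    K₁ = K₂ := by
  funext x
  have hc₁ : Continuous (K₁ x) := h₁.comp (Continuous.prodMk continuous_const continuous_id)
  have hc₂ : Continuous (K₂ x) := h₂.comp (Continuous.prodMk continuous_const continuous_id)
  set g : X → ℂ := fun y => K₁ x y - K₂ x y with hg_def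
  have hg : Continuous g := hc₁.sub hc₂
  have hψ : Continuous fun y => (starRingEnd ℂ) (g y) := Complex.continuous_conj.comp hg
  have hi₁ : Integrable (fun y => K₁ x y * (starRingEnd ℂ) (g y)) μ :=
    integrable_of_continuous μ (hc₁.mul hψ)
  have hi₂ : Integrable (fun y => K₂ x y * (starRingEnd ℂ) (g y)) μ :=
    integrable_of_continuous μ (hc₂.mul hψ)
  have hzero : ∫ y, g y * (starRingEnd ℂ) (g y) ∂μ = 0 := by
    have e : (fun y => g y * (starRingEnd ℂ) (g y)) =
        fun y => K₁ x y * (starRingEnd ℂ) (g y) - K₂ x y * (starRingEnd ℂ) (g y) := by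
      funext y; simp only [hg_def, sub_mul]
    rw [e, integral_sub hi₁ hi₂, h x _ hψ, sub_self]
  have := eq_zero_of_integral_mul_conj_eq_zero μ hg hzero
  funext y
  have hy := congrFun this y
  simp only [hg_def, Pi.zero_apply] at hy
  exact sub_eq_zero.1 hy

end Summit.Ventures.HodgeRepro2.Tier7.Line3.KernelUniqueness
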